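import Literature.AlgebraicGeometry.Motives.CurveUniversalDivisor
import Literature.AlgebraicGeometry.Motives.SmoothSeparablePoints
import HarnessLib

/-!
# Many points over one finite Galois extension: `N` distinct `L`-valued points of a smooth curve
# (Liu, Prop. 3.2.20, applied to the off-diagonal open of `Cᴺ`)

For a smooth proper geometrically integral curve `C / K` and `N : ℕ` there are a finite Galois
extension `L / K` and `N` pairwise distinct `L`-valued points `Q₁, …, Q_N : Spec L → C` over `K`
(`exists_galois_algPoints_injective`). This is the supply of "points of `C(k_s)`" used throughout
Milne, *Jacobian Varieties*, §4–§5 (e.g. Lemma 5.2 (b): points in general position), in the finite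
form appropriate to Galois descent. Proof: the power `Cᴺ` (`powC`, smooth over `K`:
`smooth_powOver_base`) contains the open `offDiag C N = {t : (tᵢ, tⱼ) ∉ Δ for i ≠ j}` (the diagonal
`Δ ⊂ C × C` is closed, `Motives/CurveDiagonalDivisor`), which is non-empty — it contains the generic
point, each `{(tᵢ, tⱼ) ∉ Δ}` being a non-empty open (`exists_pairC_notMem`: lift an off-diagonal
point of `C × C` through its residue field) — hence a smooth non-empty `K`-scheme, so it has a point
over a finite Galois `L / K` (`exists_algPoints_of_smooth`, `Motives/SmoothSeparablePoints`); its
coordinates are pairwise distinct `L`-valued points (`pairC_apply_mem_diagonalSet_of_eq`).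

Everything is proved; no named facts (D-0026).

## References

* Q. Liu, *Algebraic Geometry and Arithmetic Curves* (2002), §3.2 Prop. 2.20. [Liu2002]
* J. S. Milne, *Jacobian Varieties*, in: Arithmetic Geometry (Cornell–Silverman, eds.), Springer
  1986, §5 Lemma 5.2 (p. 251 of the volume). [Milne1986JacobianVarieties]
-/

noncomputable section

open CategoryTheory CategoryTheory.Limits AlgebraicGeometry IsLocalRing Order TopologicalSpace
  MonoidalCategory CartesianMonoidalCategory

universe u

namespace Literature.AlgebraicGeometry.Motives

open Literature.AlgebraicGeometry.RelativeSpec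

namespace CurvePlaces

variable {K : Type u} [Field K]

section OffDiagonal

variable (C : SchemeOver K) [IsIntegral C.left] [SmoothOfRelativeDimension 1 C.hom] [IsProper C.hom]
  [GeometricallyIntegral C.hom]

omit [IsIntegral C.left] [IsProper C.hom] [GeometricallyIntegral C.hom] in
/-- `Cⁿ → Spec K` is smooth. [folklore] -/
theorem smooth_powOver_base : ∀ n, Smooth (powOver.base C.hom n)
  | 0 => by
    haveI : IsIso (powOver.base C.hom 0) := inferInstance
    infer_instance
  | n + 1 => by
    haveI := smooth_powOver_base n
    rw [← powSuccIso_hom_fst_base]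
    infer_instance

/-- `Cᴺ → Spec K` is smooth. [folklore] -/
instance smooth_powC_hom (N : ℕ) : Smooth (powC C N).hom := smooth_powOver_base C N

/-- The pair of coordinates `(prᵢ, prⱼ) : Cᴺ → C × C`. [folklore] -/
def pairC (N : ℕ) (i j : Fin N) : powC C N ⟶ C ⊗ C := lift (coord C N i) (coord C N j)

/-- **The off-diagonal open** `{t ∈ Cᴺ : (tᵢ, tⱼ) ∉ Δ for i ≠ j}`. [folklore] -/
def offDiag (N : ℕ) : (powC C N).left.Opens :=
  ⟨(⋃ p : {p : Fin N × Fin N // p.1 ≠ p.2}, (pairC C N p.1.1 p.1.2).left.base ⁻¹' diagonalSet C)ᶜ, by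
    rw [isOpen_compl_iff]
    exact isClosed_iUnion_of_finite fun p ↦
      (isClosed_diagonalSet C).preimage (pairC C N p.1.1 p.1.2).left.continuous⟩

omit [IsIntegral C.left] [SmoothOfRelativeDimension 1 C.hom] [GeometricallyIntegral C.hom] in
/-- Membership in the off-diagonal open. [folklore] -/
theorem mem_offDiag_iff {N : ℕ} (t : (powC C N).left) :
    t ∈ offDiag C N ↔ ∀ i j : Fin N, i ≠ j → (pairC C N i j).left t ∉ diagonalSet C := by
  change t ∈ (⋃ p : {p : Fin N × Fin N // p.1 ≠ p.2}, _)ᶜ ↔ _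
  simp only [Set.mem_compl_iff, Set.mem_iUnion, Set.mem_preimage, not_exists]
  exact ⟨fun h i j hij ↦ h ⟨(i, j), hij⟩, fun h p ↦ h p.1.1 p.1.2 p.2⟩

/-- For `i ≠ j` some point of `Cᴺ` has `(tᵢ, tⱼ) ∉ Δ`: lift an off-diagonal point `z` of `C × C` to
`Cᴺ` through its residue field (coordinates `z₁` at `i`, `z₂` elsewhere). [folklore] -/
theorem exists_pairC_notMem {N : ℕ} (i j : Fin N) (hij : i ≠ j) :
    ∃ t : (powC C N).left, (pairC C N i j).left t ∉ diagonalSet C := by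
  obtain ⟨⟨z, hz⟩⟩ := nonempty_diagonalCompl C
  -- the `κ(z)`-valued point of `C × C` and its two coordinates
  let ζ : residuePt (C ⊗ C) z ⟶ C ⊗ C := residuePtι (C ⊗ C) z
  let t : residuePt (C ⊗ C) z ⟶ powC C N :=
    liftOver C.hom N fun l ↦ if l = i then ζ ≫ fst C C else ζ ≫ snd C C
  refine ⟨t.left (closedPoint _), ?_⟩
  have hpair : t ≫ pairC C N i j = ζ := by
    apply CartesianMonoidalCategory.hom_ext
    · rw [Category.assoc, pairC, lift_fst]
      change liftOver C.hom N _ ≫ projOver C.hom N i = _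
      rw [liftOver_projOver]
      exact if_pos rfl
    · rw [Category.assoc, pairC, lift_snd]
      change liftOver C.hom N _ ≫ projOver C.hom N j = _
      rw [liftOver_projOver]
      exact if_neg hij.symm
  rw [← Scheme.Hom.comp_apply, ← Over.comp_left, hpair]
  change (residuePtι (C ⊗ C) z).left (closedPoint _) ∉ diagonalSet C
  rwa [residuePtι_left_apply]

/-- **The off-diagonal open contains the generic point** (it is a finite intersection of non-empty
opens of the integral scheme `Cᴺ`). [folklore] -/
theorem genericPoint_mem_offDiag (N : ℕ) : genericPoint (powC C N).left ∈ offDiag C N := by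
  rw [mem_offDiag_iff]
  intro i j hij hmem
  obtain ⟨t, ht⟩ := exists_pairC_notMem C i j hij
  have hopen : IsOpen ((pairC C N i j).left.base ⁻¹' (diagonalSet C)ᶜ) :=
    (isClosed_diagonalSet C).isOpen_compl.preimage (pairC C N i j).left.continuous
  have hgen := (genericPoint_spec (powC C N).left).mem_open_set_iff hopen
  have hne : (Set.univ ∩ (pairC C N i j).left.base ⁻¹' (diagonalSet C)ᶜ).Nonempty := ⟨t, trivial, ht⟩
  exact (hgen.2 hne) hmem

/-- The off-diagonal open as a `K`-scheme. [folklore] -/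
def offDiagOver (N : ℕ) : SchemeOver K := Over.mk ((offDiag C N).ι ≫ (powC C N).hom)

/-- `offDiag ↪ Cᴺ` over `K`. [folklore] -/
def offDiagIncl (N : ℕ) : offDiagOver C N ⟶ powC C N := Over.homMk (offDiag C N).ι rfl

/-- The off-diagonal open is smooth over `K`. [folklore] -/
instance smooth_offDiagOver_hom (N : ℕ) : Smooth (offDiagOver C N).hom := by
  change Smooth ((offDiag C N).ι ≫ (powC C N).hom)
  infer_instance

/-- The off-diagonal open is non-empty (generic point). [folklore] -/
instance nonempty_offDiagOver_left (N : ℕ) : Nonempty (offDiagOver C N).left :=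
  ⟨(⟨genericPoint (powC C N).left, genericPoint_mem_offDiag C N⟩ : offDiag C N)⟩

end OffDiagonal

/-! ### Many points over one finite Galois extension -/

section ManyPoints

variable (C : SchemeOver K) [IsIntegral C.left] [SmoothOfRelativeDimension 1 C.hom] [IsProper C.hom]
  [GeometricallyIntegral C.hom]

omit [IsIntegral C.left] [SmoothOfRelativeDimension 1 C.hom] [IsProper C.hom] [GeometricallyIntegral C.hom] in
/-- Two `L`-valued points with equal coordinates map into the diagonal. [folklore] -/
theorem pairC_apply_mem_diagonalSet_of_eq {N : ℕ} {L : Type u} [Field L] [Algebra K L]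
    (t : AlgPoints (powC C N) L) {i j : Fin N} (h : t ≫ coord C N i = t ≫ coord C N j) (s : Spec (.of L)) :
    (pairC C N i j).left (t.left s) ∈ diagonalSet C := by
  have hfac : t ≫ pairC C N i j = (t ≫ coord C N i) ≫ diag C := by
    rw [pairC, comp_lift, diag, comp_lift, Category.comp_id, ← h]
  rw [← Scheme.Hom.comp_apply, ← Over.comp_left, hfac, Over.comp_left, Scheme.Hom.comp_apply]
  exact ⟨_, rfl⟩

/-- **A smooth proper geometrically integral curve has, over a suitable finite Galois extension
`L / K`, any prescribed finite number of pairwise distinct `L`-valued points** (Liu, Prop. 3.2.20 /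
density of separable points, applied to the off-diagonal open of `Cᴺ`; Milne, *Jacobian Varieties*,
§4–§5: "points of `C(k_s)`" in general position). [cite: Liu2002, §3.2 Prop. 2.20] [cite: Milne1986JacobianVarieties, §5 Lemma 5.2 (b)] -/
theorem exists_galois_algPoints_injective (N : ℕ) :
    ∃ (L : Type u) (_ : Field L) (_ : Algebra K L), FiniteDimensional K L ∧ IsGalois K L ∧
      ∃ Q : Fin N → AlgPoints C L, Function.Injective Q := by
  obtain ⟨L, _, _, hfin, hgal, ⟨P⟩⟩ := exists_algPoints_of_smooth (offDiagOver C N)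
  refine ⟨L, inferInstance, inferInstance, hfin, hgal, fun i ↦ (P ≫ offDiagIncl C N) ≫ coord C N i,
    fun i j hij ↦ ?_⟩
  by_contra hne
  have hmem := pairC_apply_mem_diagonalSet_of_eq C (P ≫ offDiagIncl C N) hij (closedPoint L)
  have hoff : (P ≫ offDiagIncl C N).left (closedPoint L) ∈ offDiag C N := by
    rw [Over.comp_left, Scheme.Hom.comp_apply]
    exact (P.left (closedPoint L)).2
  exact (mem_offDiag_iff C _).1 hoff i j hne hmem

end ManyPoints

end CurvePlaces

end Literature.AlgebraicGeometry.Motives
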